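/-
Copyright (c) 2026. Released under Apache 2.0 license.
-/
import Literature.NumberTheory.Automorphic.UnboundedDenominatorsInvariantHomCyclic
import Literature.NumberTheory.Automorphic.UnboundedDenominatorsInvariantHomGamma1
import Literature.NumberTheory.EllipticCurves.ModularCurveGammaIndex
import Mathlib.FieldTheory.Finite.Basic
import HarnessLib

/-!
# The invariant form of CDT Cor. 4.5.3 at prime level `N = p` for targets of order prime to `p + 1`

For a prime `p` and an `SL₂(ℤ)`-conjugation-invariant homomorphism `θ : Γ(p) → Q` into a finite commutative
group we prove: **if `|Q|` is prime to `p + 1` then `θ` is trivial on `Γ(12p)`**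
(`cor453_invariant_form_prime_level_of_coprime_succ`).  The `p`-primary part of `θ` is handled by the subgroup
`Γ₁(p)` (index `p² - 1`, `UnboundedDenominatorsInvariantHomGamma1`) and the part of order prime to `p` by the
preimage of the SPLIT CARTAN subgroup `⟨diag(g, g⁻¹)⟩ ≤ SL₂(𝔽_p)` (`g` a primitive root; cyclic of order `p - 1`,
index `p(p + 1)`; `UnboundedDenominatorsInvariantHomCyclic`), glued through the "exponent form" of the transfer
reduction (`map_eq_one_of_mem_Gamma_mul_of_local_of_pow_eq_one`).  In particular the invariant classes in
`H¹(Γ(p), 𝐅_ℓ)` are congruence of level `12p` for every prime `ℓ ∤ p + 1`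
(`cor453_invariant_form_prime_level_prime_target`).

Not here: targets of prime order `ℓ ∣ p + 1` (`ℓ` odd: the non-split Cartan subgroup, an element of order `p + 1`
of `SL₂(𝔽_p)`; `ℓ = 2`: the dicyclic normaliser of a Cartan subgroup), see the crux memo
`Lines/cdt_thm1-hcor-structure-g40.md`. [cite: CalegariDimitrovTang2025, Corollary 4.5.3]
-/

open scoped MatrixGroups

namespace Literature.NumberTheory.Automorphic

namespace UnboundedDenominators

open CongruenceSubgroup Matrix.SpecialLinearGroup ModularGroup
open Literature.NumberTheory.EllipticCurves.ModularForms (Gamma_le_Gamma1 index_Gamma_eq_card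
  index_Gamma_eq_mul)

variable {N : ℕ} {Q : Type*} [CommGroup Q]

/-! ### The transfer reduction in exponent form -/

/-- **Transfer reduction, exponent form**: as `map_eq_one_of_mem_Gamma_mul_of_local`, with the finiteness of
`Q` replaced by an exponent `e` of the image of `θ` (`θ(x)^e = 1` for all `x`) prime to `[SL₂(ℤ) : H]`.
[cite: CalegariDimitrovTang2025, Corollary 4.5.3] -/
theorem map_eq_one_of_mem_Gamma_mul_of_local_of_pow_eq_one (θ : Gamma N →* Q)
    (hθ : ∀ (g x : SL(2, ℤ)) (hx : x ∈ Gamma N) (hgx : g * x * g⁻¹ ∈ Gamma N),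
      θ ⟨g * x * g⁻¹, hgx⟩ = θ ⟨x, hx⟩)
    [hK : (θ.ker.map (Gamma N).subtype).Normal]
    (H : Subgroup SL(2, ℤ)) [H.FiniteIndex] (hH : Gamma N ≤ H) {e : ℕ} (he : ∀ x : Gamma N, θ x ^ e = 1)
    (hcop : e.Coprime H.index)
    (loc : ∀ (y : SL(2, ℤ)) (hy : y ∈ Gamma N), y ∈ ⁅H, H⁆ ⊔ θ.ker.map (Gamma N).subtype → θ ⟨y, hy⟩ = 1)
    (x : SL(2, ℤ)) (hx : x ∈ Gamma N) (hx12 : x ∈ Gamma (12 * N)) : θ ⟨x, hx⟩ = 1 := by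
  refine map_eq_one_of_mem_Gamma_mul_of_commutator θ (fun y hy hyc ↦ ?_) x hx hx12
  set K : Subgroup SL(2, ℤ) := θ.ker.map (Gamma N).subtype with hKdef
  set π : SL(2, ℤ) →* SL(2, ℤ) ⧸ K := QuotientGroup.mk' K with hπ
  set H' : Subgroup (SL(2, ℤ) ⧸ K) := H.map π with hH'
  have hidx : H'.index = H.index := index_map_mk'_eq θ H hH
  haveI : H'.FiniteIndex := ⟨by rw [hidx]; exact Subgroup.FiniteIndex.index_ne_zero⟩
  have hyH' : π y ∈ H' := Subgroup.mem_map_of_mem π (hH hy)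
  have hcen : π y ∈ Subgroup.center (SL(2, ℤ) ⧸ K) := mk_mem_center_of_mem_Gamma θ hθ hy
  have ht := pow_index_mem_commutator_of_mem_center H' hyH' hcen hyc
  have hmapcomm : (commutator H').map H'.subtype = ⁅H', H'⁆ := by
    rw [commutator_def, Subgroup.map_commutator, ← MonoidHom.range_eq_map, Subgroup.range_subtype]
  have h2 : (π y) ^ H'.index ∈ ⁅H', H'⁆ := by
    rw [← hmapcomm]
    exact ⟨_, ht, by simp⟩
  have h1 : π (y ^ H.index) ∈ (⁅H, H⁆).map π := by
    rw [map_pow, ← hidx, Subgroup.map_commutator]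
    exact h2
  obtain ⟨c, hc, hcy⟩ := h1
  have hyn : y ^ H.index ∈ ⁅H, H⁆ ⊔ K := by
    rw [Subgroup.mem_sup_of_normal_right]
    refine ⟨c, hc, c⁻¹ * y ^ H.index, ?_, by group⟩
    rw [← QuotientGroup.eq, ← QuotientGroup.mk'_apply, ← QuotientGroup.mk'_apply, ← hπ, hcy]
  have hθn : θ ⟨y, hy⟩ ^ H.index = 1 := by
    have := loc (y ^ H.index) (Subgroup.pow_mem _ hy _) hyn
    rwa [← map_pow]
  have h3 : orderOf (θ ⟨y, hy⟩) ∣ Nat.gcd e H.index :=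
    Nat.dvd_gcd (orderOf_dvd_of_pow_eq_one (he ⟨y, hy⟩)) (orderOf_dvd_of_pow_eq_one hθn)
  rw [Nat.Coprime.gcd_eq_one hcop, Nat.dvd_one] at h3
  exact orderOf_eq_one_iff.mp h3

/-- **Cyclic-subgroup case, exponent form**: if `θ(x)^e = 1` for all `x` with `e` prime to `[SL₂(ℤ/N) : ⟨c̄⟩]`
for some `c̄ ∈ SL₂(ℤ/N)`, then the invariant `θ` kills `Γ(12N)`. [cite: CalegariDimitrovTang2025, Corollary 4.5.3] -/
theorem map_eq_one_of_mem_Gamma_mul_of_zpowers_of_pow_eq_one [NeZero N] (θ : Gamma N →* Q)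
    (hθ : ∀ (g x : SL(2, ℤ)) (hx : x ∈ Gamma N) (hgx : g * x * g⁻¹ ∈ Gamma N),
      θ ⟨g * x * g⁻¹, hgx⟩ = θ ⟨x, hx⟩)
    (cbar : SL(2, ZMod N)) {e : ℕ} (he : ∀ x : Gamma N, θ x ^ e = 1)
    (hcop : e.Coprime (Subgroup.zpowers cbar).index) :
    ∀ (x : SL(2, ℤ)) (hx : x ∈ Gamma N), x ∈ Gamma (12 * N) → θ ⟨x, hx⟩ = 1 := by
  haveI := ker_map_subtype_normal θ hθ
  obtain ⟨hΓ, hidx, c, hc⟩ := comap_zpowers_spec cbar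
  set H := (Subgroup.zpowers cbar).comap (Matrix.SpecialLinearGroup.map (Int.castRingHom (ZMod N)))
  haveI : H.FiniteIndex := ⟨by rw [hidx]; exact Subgroup.FiniteIndex.index_ne_zero⟩
  refine map_eq_one_of_mem_Gamma_mul_of_local_of_pow_eq_one θ hθ H hΓ he (by rwa [hidx]) ?_
  intro y hy hyc
  rw [sup_eq_right.mpr (commutator_le_ker_of_forall_eq_zpow_mul θ hθ H c hc)] at hyc
  obtain ⟨_, h1⟩ := (mem_ker_map_subtype_iff θ).mp hyc
  exact h1

/-! ### The split Cartan subgroup at prime level -/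

/-- **The split Cartan subgroup of `SL₂(𝔽_p)`**: there is `c̄ ∈ SL₂(ℤ/p)` (namely `diag(g, g⁻¹)` for a primitive
root `g`) with `[SL₂(ℤ/p) : ⟨c̄⟩] = p (p + 1)`. [cite: DiamondShurman2005, §1.2 and Exercise 1.2.3] -/
theorem exists_zpowers_index_eq_mul_succ {p : ℕ} (hp : p.Prime) :
    ∃ cbar : SL(2, ZMod p), (Subgroup.zpowers cbar).index = p * (p + 1) := by
  haveI : Fact p.Prime := ⟨hp⟩
  -- the diagonal embedding of `(ℤ/p)ˣ`
  have hdet : ∀ u : (ZMod p)ˣ, Matrix.det !![(u : ZMod p), 0; 0, ((u⁻¹ : (ZMod p)ˣ) : ZMod p)] = 1 := by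
    intro u
    rw [Matrix.det_fin_two_of, mul_zero, sub_zero, ← Units.val_mul, mul_inv_cancel, Units.val_one]
  let d : (ZMod p)ˣ →* SL(2, ZMod p) := MonoidHom.mk'
    (fun u ↦ ⟨!![(u : ZMod p), 0; 0, ((u⁻¹ : (ZMod p)ˣ) : ZMod p)], hdet u⟩)
    (fun u v ↦ by
      ext i j
      fin_cases i <;> fin_cases j <;>
        simp only [mul_inv_rev, Units.val_mul, Matrix.SpecialLinearGroup.coe_mul, Matrix.mul_apply,
          Fin.sum_univ_two, Matrix.of_apply, Matrix.cons_val', Matrix.cons_val_zero, Matrix.cons_val_one,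
          Matrix.cons_val_fin_one, Matrix.empty_val', Fin.isValue, Fin.mk_one, Fin.zero_eta, mul_zero,
          add_zero, zero_add, mul_comm])
  have hd : Function.Injective d := by
    intro u v huv
    have h := congrArg (fun A : SL(2, ZMod p) ↦ (A : Matrix (Fin 2) (Fin 2) (ZMod p)) 0 0) huv
    exact Units.ext h
  obtain ⟨g, hg⟩ := IsCyclic.exists_generator (α := (ZMod p)ˣ)
  refine ⟨d g, ?_⟩
  have horder : orderOf (d g) = p - 1 := by
    rw [orderOf_injective d hd g, orderOf_eq_card_of_forall_mem_zpowers hg, Nat.card_eq_fintype_card,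
      ZMod.card_units p]
  have hcard : Nat.card SL(2, ZMod p) = p * ((p + 1) * (p - 1)) := by
    haveI : NeZero p := ⟨hp.ne_zero⟩
    rw [← index_Gamma_eq_card, index_Gamma_eq_mul, index_Gamma1_prime hp]
  have h := (Subgroup.zpowers (d g)).index_mul_card
  rw [Nat.card_zpowers, horder, hcard, ← mul_assoc] at h
  exact Nat.eq_of_mul_eq_mul_right (Nat.sub_pos_of_lt hp.one_lt) h

/-! ### Prime level, targets of order prime to `p + 1` -/

/-- **Invariant form of CDT Cor. 4.5.3 at prime level `p`, targets of order prime to `p + 1`**: every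
`SL₂(ℤ)`-conjugation-invariant `θ : Γ(p) → Q` (`Q` finite commutative, `gcd(|Q|, p + 1) = 1`) is trivial on
`Γ(12p)`.  The `p`-primary part `θ^{m}` (`|Q| = p^a m`) is handled by `Γ₁(p)`, the prime-to-`p` part `θ^{p^a}`
by the split Cartan subgroup. [cite: CalegariDimitrovTang2025, Corollary 4.5.3] -/
theorem cor453_invariant_form_prime_level_of_coprime_succ {p : ℕ} (hp : p.Prime) (Q : Type*) [CommGroup Q]
    [Finite Q] (hQ : (Nat.card Q).Coprime (p + 1)) (θ : Gamma p →* Q)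
    (hθ : ∀ (g x : SL(2, ℤ)) (hx : x ∈ Gamma p) (hgx : g * x * g⁻¹ ∈ Gamma p),
      θ ⟨g * x * g⁻¹, hgx⟩ = θ ⟨x, hx⟩) :
    ∀ (x : SL(2, ℤ)) (hx : x ∈ Gamma p), x ∈ Gamma (12 * p) → θ ⟨x, hx⟩ = 1 := by
  haveI : NeZero p := ⟨hp.ne_zero⟩
  haveI : Fact p.Prime := ⟨hp⟩
  intro x hx hx12
  set n : ℕ := Nat.card Q with hn
  have hn0 : n ≠ 0 := Nat.card_pos.ne'
  -- `n = p^a · m` with `p ∤ m`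
  set pa : ℕ := ordProj[p] n with hpa
  set m : ℕ := ordCompl[p] n with hm
  have hnm : pa * m = n := Nat.ordProj_mul_ordCompl_eq_self n p
  have hpm : Nat.Coprime p m := Nat.coprime_ordCompl hp hn0
  -- invariance of the power maps `θ^k`
  have hinv : ∀ k : ℕ, ∀ (g x : SL(2, ℤ)) (hx : x ∈ Gamma p) (hgx : g * x * g⁻¹ ∈ Gamma p),
      ((powMonoidHom k).comp θ) ⟨g * x * g⁻¹, hgx⟩ = ((powMonoidHom k).comp θ) ⟨x, hx⟩ := by
    intro k g x hx hgx
    simp only [MonoidHom.comp_apply, hθ g x hx hgx]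
  have hpow : ∀ (k : ℕ) (y : Gamma p), ((powMonoidHom k).comp θ) y = θ y ^ k := fun k y ↦ rfl
  -- (1) `θ^m` has exponent `p^a`, prime to `[SL₂(ℤ) : Γ₁(p)] = p² - 1`
  have h1 : θ ⟨x, hx⟩ ^ m = 1 := by
    have he : ∀ y : Gamma p, ((powMonoidHom m).comp θ) y ^ pa = 1 := by
      intro y
      rw [hpow, ← pow_mul, mul_comm, hnm, hn]
      exact pow_card_eq_one'
    have hcop : pa.Coprime (Gamma1 p).index := by
      rw [hpa, index_Gamma1_prime hp]
      refine Nat.Coprime.pow_left _ (Nat.Coprime.mul_right ?_ ?_)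
      · exact Nat.coprime_self_add_right.mpr (Nat.coprime_one_right p)
      · have h : p = 1 + (p - 1) := (Nat.add_sub_cancel' hp.one_le).symm
        conv_lhs => rw [h]
        exact Nat.coprime_add_self_left.mpr (Nat.coprime_one_left _)
    haveI := ker_map_subtype_normal ((powMonoidHom m).comp θ) (hinv m)
    have := map_eq_one_of_mem_Gamma_mul_of_local_of_pow_eq_one ((powMonoidHom m).comp θ) (hinv m)
      (Gamma1 p) (Gamma_le_Gamma1 p) he hcop (fun y hy hyc ↦ by
        rw [sup_eq_right.mpr (commutator_Gamma1_le_ker _ (hinv m))] at hyc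
        obtain ⟨_, h⟩ := (mem_ker_map_subtype_iff _).mp hyc
        exact h) x hx hx12
    rwa [hpow] at this
  -- (2) `θ^{p^a}` has exponent `m`, prime to `p(p+1) = [SL₂(𝔽_p) : split Cartan]`
  have h2 : θ ⟨x, hx⟩ ^ pa = 1 := by
    have he : ∀ y : Gamma p, ((powMonoidHom pa).comp θ) y ^ m = 1 := by
      intro y
      rw [hpow, ← pow_mul, hnm, hn]
      exact pow_card_eq_one'
    obtain ⟨cbar, hcbar⟩ := exists_zpowers_index_eq_mul_succ hp
    have hcop : m.Coprime (Subgroup.zpowers cbar).index := by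
      rw [hcbar]
      exact Nat.Coprime.mul_right hpm.symm (Nat.Coprime.coprime_dvd_left (Nat.ordCompl_dvd n p) hQ)
    have := map_eq_one_of_mem_Gamma_mul_of_zpowers_of_pow_eq_one ((powMonoidHom pa).comp θ) (hinv pa)
      cbar he hcop x hx hx12
    rwa [hpow] at this
  -- (3) `gcd(m, p^a) = 1`
  have h3 : orderOf (θ ⟨x, hx⟩) ∣ Nat.gcd m pa :=
    Nat.dvd_gcd (orderOf_dvd_of_pow_eq_one h1) (orderOf_dvd_of_pow_eq_one h2)
  rw [Nat.Coprime.gcd_eq_one (Nat.Coprime.pow_right _ hpm.symm), Nat.dvd_one] at h3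
  exact orderOf_eq_one_iff.mp h3

/-- The prime-level case in the exact shape of the invariant form (`M = 12p`).
[cite: CalegariDimitrovTang2025, Corollary 4.5.3] -/
theorem cor453_invariant_form_prime_level_of_coprime_succ' {p : ℕ} (hp : p.Prime) (Q : Type*)
    [CommGroup Q] [Finite Q] (hQ : (Nat.card Q).Coprime (p + 1)) (θ : Gamma p →* Q)
    (hθ : ∀ (g x : SL(2, ℤ)) (hx : x ∈ Gamma p) (hgx : g * x * g⁻¹ ∈ Gamma p),
      θ ⟨g * x * g⁻¹, hgx⟩ = θ ⟨x, hx⟩) :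
    ∃ M : ℕ, M ≠ 0 ∧ ∀ (x : SL(2, ℤ)) (hx : x ∈ Gamma p), x ∈ Gamma M → θ ⟨x, hx⟩ = 1 :=
  ⟨12 * p, Nat.mul_ne_zero (by norm_num) hp.ne_zero,
    cor453_invariant_form_prime_level_of_coprime_succ hp Q hQ θ hθ⟩

/-- **Invariant classes in `H¹(Γ(p), 𝐅_ℓ)` are congruence (of level `12p`) for every prime `ℓ ∤ p + 1`**:
an `SL₂(ℤ)`-invariant homomorphism from `Γ(p)` to a group of prime order `ℓ` with `ℓ ∤ p + 1` is trivial on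
`Γ(12p)`. [cite: CalegariDimitrovTang2025, Corollary 4.5.3] -/
theorem cor453_invariant_form_prime_level_prime_target {p ℓ : ℕ} (hp : p.Prime) (hℓ : ℓ.Prime)
    (hℓp : ¬ ℓ ∣ p + 1) (C : Type*) [CommGroup C] [Finite C] (hC : Nat.card C = ℓ) (θ : Gamma p →* C)
    (hθ : ∀ (g x : SL(2, ℤ)) (hx : x ∈ Gamma p) (hgx : g * x * g⁻¹ ∈ Gamma p),
      θ ⟨g * x * g⁻¹, hgx⟩ = θ ⟨x, hx⟩) :
    ∀ (x : SL(2, ℤ)) (hx : x ∈ Gamma p), x ∈ Gamma (12 * p) → θ ⟨x, hx⟩ = 1 :=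
  cor453_invariant_form_prime_level_of_coprime_succ hp C
    (by rw [hC]; exact (Nat.Prime.coprime_iff_not_dvd hℓ).mpr hℓp) θ hθ

end UnboundedDenominators

end Literature.NumberTheory.Automorphic
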